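import Literature.MathematicalPhysics.KineticTheory.HardSphereTwoTimePressure
import Summits.AtomisticToContinuum.HydrodynamicLimit.Theorems.AnnealedZeroHorizonMeanFluxClosureCollisionalStressClosure
import HarnessLib

/-!
# Stub CS `stub_collisionalStressClosure` of crux `MeanFluxClosure`
# (stmt-AtomisticToContinuum-9256, route AnnealedZeroHorizon, line `registered`): EOS-free part B,
# the Taylor remainder in mean and the local Gibbs law with the stub's normalisation `c = (N+1)⁻¹`

Companion of `AnnealedZeroHorizonMeanFluxClosureCollisionalStressClosure.lean` (pathwise contact form
of the collisional momentum transfer `W_φ`, conditional integrability of `W_φ ∘ Φ_{t₁}` under laws `≪`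
Liouville). Here:

* `aemeasurable_collisionalStress_flow`,
  `integrable_momentumTransfer_sub_collisionalStress_flow_of_integrable_relSpeed` — under any law `≪`
  Liouville (`ε < 1/2`): IF the relative-speed functional `RS ∘ Φ_{t₁}` over `(0, t₂ − t₁]` is
  integrable THEN the Taylor remainder `(W_φ − collisionalStress (Dφ)) ∘ Φ_{t₁}` is integrable with
  `∫ |·| ≤ ½ ‖D²φ‖_∞ ε² · ½ ∫ RS ∘ Φ_{t₁}` — one order in `ε` below the transfer itself.
* `integrable_avg_momentumTransfer_flow_localGibbsLaw`,
  `integrable_avg_momentumTransfer_sub_collisionalStress_flow_localGibbsLaw` — the two conditional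
  statements under `μ_N = localGibbsLaw σ a₀ u₀ θ₀ N Φ` (absolutely continuous w.r.t. Liouville for
  every `σ`, all profiles, every `N`) with `σ_N = hsDiameter σ N` and the factor `c = (N+1)⁻¹` of the
  stub's functional `z ↦ c · W_φ(Φ_{t₁} z, t₂ − t₁)`:
  `∫ |c W_φ ∘ Φ_{t₁}| dμ_N ≤ ‖Dφ‖_∞ σ_N c · ½ ∫ RS ∘ Φ_{t₁} dμ_N` and
  `∫ |c (W_φ − collisionalStress (Dφ)) ∘ Φ_{t₁}| dμ_N ≤ ½ ‖D²φ‖_∞ σ_N² c · ½ ∫ RS ∘ Φ_{t₁} dμ_N`; so,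
  GIVEN a mean bound `σ_N c ∫ RS dμ_N ≤ C` (stub FLUX; `mmr_collisionFlux_const` in equilibrium), the
  stub's `c W_φ` may be replaced by the collision-indexed stress `c · collisionalStress (Dφ)` at cost
  `O(σ_N) → 0`, reducing stub CS to the virial closure in mean of `c · collisionalStress (Dφ)` against
  `J_φ − I_φ` ((D1) + equation of state; open).
* `stub_collisionalStressTransferMeanBound` — the registered sub-goal of stmt-AtomisticToContinuum-9256
  packaging both statements for a smooth `φ` (`Torus.IsSmooth`, as in the stub) with constants
  `L, M` chosen once for all `σ, N, Φ, t₁, t₂` and all profiles.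

References: H. Spohn, *Large Scale Dynamics of Interacting Particles* (1991), Part I §3.2 (3.7),
(3.15); R. Soto, *Kinetic Theory and Transport Phenomena* (2016) §4.8.1 (4.88)–(4.91).
-/

noncomputable section

namespace Summit.AtomisticToContinuum.HydrodynamicLimit.Theorems

open scoped BigOperators ENNReal Topology InnerProductSpace
open MeasureTheory Set Filter Function
open Literature.MathematicalPhysics.KineticTheory Literature.Analysis.FluidPDE Literature.Analysis.FunctionSpaces

namespace CollisionalStressClosure

/-! ## The Taylor remainder in mean under laws absolutely continuous w.r.t. Liouville -/

section Mean

variable {d : Type*} [Fintype d] {N : ℕ} {ε : ℝ} (Φ : HardSphereFlow (Torus.geometry d) ε N)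

/-- The collisional stress of the time-`t₁` point over `(0, t₂ − t₁]` against a continuous matrix
field is a.e.-measurable in the datum under any law `≪` Liouville (`ε < 1/2`; cocycle +
`CollisionalTransferFunctionalMeasurable`). [folklore] -/
theorem aemeasurable_collisionalStress_flow (hε : ε < 2⁻¹)
    {A : UnitAddTorus d → EuclideanSpace ℝ d →L[ℝ] EuclideanSpace ℝ d} (hA : Continuous A)
    {t₁ t₂ : ℝ} (h₁ : 0 ≤ t₁) (h₁₂ : t₁ ≤ t₂)
    {μ : Measure (Config N d (UnitAddTorus d))} (hμ : μ ≪ liouville (Torus.geometry d) N ε) :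
    AEMeasurable (fun z => Φ.collisionalStress A (Φ.flow t₁ z) (t₂ - t₁)) μ := by
  have hμ' : μ Φ.goodᶜ = 0 := Φ.measure_compl_good_of_absolutelyContinuous hμ
  have hcocycle : (fun z => Φ.collisionalStress A (Φ.flow t₁ z) (t₂ - t₁)) =ᵐ[μ]
      fun z => Φ.collisionalStress A z t₂ - Φ.collisionalStress A z t₁ := by
    filter_upwards [hμ.ae_le Φ.ae_mem_good] with z hz
    have := Φ.collisionalTransferFunctional_add Torus.continuous_geometry_translate
      (stressKernel (Torus.geometry d) A) hz h₁ (sub_nonneg.2 h₁₂)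
    rw [add_sub_cancel] at this
    simp only [HardSphereFlow.collisionalStress]
    rw [this]
    ring
  have hm : ∀ h : ℝ, AEMeasurable (fun z => Φ.collisionalStress A z h) μ := fun h =>
    Φ.aemeasurable_of_measurable_indicator (Φ.measurable_indicator_collisionalStress_torus hε hA h) hμ'
  exact ((hm t₂).sub (hm t₁)).congr hcocycle.symm

/-- **Conditional integrability of the Taylor remainder** (any law `μ ≪` Liouville, `ε < 1/2`,
`φ ∈ C¹`, `Dφ ∈ C¹`, `‖D²φ‖ ≤ M`, `0 ≤ t₁ ≤ t₂`): if `RS ∘ Φ_{t₁}` is `μ`-integrable then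
`(W_φ − collisionalStress (Dφ)) ∘ Φ_{t₁}` is `μ`-integrable with
`∫ |·| dμ ≤ ½ M ε² · ½ ∫ RS ∘ Φ_{t₁} dμ` — one order in `ε` below the transfer itself. [folklore] -/
theorem integrable_momentumTransfer_sub_collisionalStress_flow_of_integrable_relSpeed (hε : ε < 2⁻¹)
    {φ : UnitAddTorus d → EuclideanSpace ℝ d} (hφ : Torus.IsContDiff 1 φ)
    (hDφ : Torus.IsContDiff 1 (Torus.fderiv φ)) {M : ℝ} (hM : ∀ x, ‖Torus.fderiv (Torus.fderiv φ) x‖ ≤ M)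
    {t₁ t₂ : ℝ} (h₁ : 0 ≤ t₁) (h₁₂ : t₁ ≤ t₂)
    {μ : Measure (Config N d (UnitAddTorus d))} (hμ : μ ≪ liouville (Torus.geometry d) N ε)
    (hRS : Integrable (fun z => Φ.collisionalTransferFunctional
      (fun i j pre _ => ‖(pre i).2 - (pre j).2‖) (Φ.flow t₁ z) (t₂ - t₁)) μ) :
    Integrable (fun z => Φ.momentumTransfer φ (Φ.flow t₁ z) (t₂ - t₁) -
        Φ.collisionalStress (Torus.fderiv φ) (Φ.flow t₁ z) (t₂ - t₁)) μ ∧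
      ∫ z, |Φ.momentumTransfer φ (Φ.flow t₁ z) (t₂ - t₁) -
          Φ.collisionalStress (Torus.fderiv φ) (Φ.flow t₁ z) (t₂ - t₁)| ∂μ ≤
        2⁻¹ * M * ε ^ 2 * (2⁻¹ * ∫ z, Φ.collisionalTransferFunctional
          (fun i j pre _ => ‖(pre i).2 - (pre j).2‖) (Φ.flow t₁ z) (t₂ - t₁) ∂μ) := by
  have hM0 : 0 ≤ M := (norm_nonneg _).trans (hM 0)
  have hdom : ∀ᵐ z ∂μ, ‖Φ.momentumTransfer φ (Φ.flow t₁ z) (t₂ - t₁) -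
      Φ.collisionalStress (Torus.fderiv φ) (Φ.flow t₁ z) (t₂ - t₁)‖ ≤
      2⁻¹ * M * ε ^ 2 * (2⁻¹ * Φ.collisionalTransferFunctional
        (fun i j pre _ => ‖(pre i).2 - (pre j).2‖) (Φ.flow t₁ z) (t₂ - t₁)) := by
    filter_upwards [hμ.ae_le Φ.ae_mem_good] with z hz
    rw [Real.norm_eq_abs]
    refine (abs_momentumTransfer_flow_sub_collisionalStress_le Φ hε hφ hDφ hM hz t₁ (t₂ - t₁)).trans ?_
    exact mul_le_mul_of_nonneg_left (mul_le_mul_of_nonneg_left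
      (speedJumpFunctional_le_relSpeedFunctional (Φ.isTrajectory _ (Φ.mapsTo_good t₁ hz)) 0 _)
      (by norm_num)) (by positivity)
  have hmeas : AEMeasurable (fun z => Φ.momentumTransfer φ (Φ.flow t₁ z) (t₂ - t₁) -
      Φ.collisionalStress (Torus.fderiv φ) (Φ.flow t₁ z) (t₂ - t₁)) μ :=
    (aemeasurable_momentumTransfer_flow Φ hφ h₁ h₁₂ hμ).sub
      (aemeasurable_collisionalStress_flow Φ hε (Torus.continuous_fderiv hφ) h₁ h₁₂ hμ)
  have hint := ((hRS.const_mul 2⁻¹).const_mul (2⁻¹ * M * ε ^ 2)).mono' hmeas.aestronglyMeasurable hdom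
  refine ⟨hint, ?_⟩
  calc ∫ z, |Φ.momentumTransfer φ (Φ.flow t₁ z) (t₂ - t₁) -
          Φ.collisionalStress (Torus.fderiv φ) (Φ.flow t₁ z) (t₂ - t₁)| ∂μ
      ≤ ∫ z, 2⁻¹ * M * ε ^ 2 * (2⁻¹ * Φ.collisionalTransferFunctional
          (fun i j pre _ => ‖(pre i).2 - (pre j).2‖) (Φ.flow t₁ z) (t₂ - t₁)) ∂μ :=
        integral_mono_ae hint.abs ((hRS.const_mul 2⁻¹).const_mul _)
          (hdom.mono fun z hz => by simpa only [Real.norm_eq_abs] using hz)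
    _ = _ := by rw [integral_const_mul, integral_const_mul]

end Mean

/-! ## Under the local Gibbs law, with the normalisation `c = (N+1)⁻¹` of the stub -/

section LocalGibbs

variable {σ : ℝ} (a₀ θ₀ : T3 → ℝ) (u₀ : T3 → V3) (N : ℕ)
  (Φ : HardSphereFlow (Torus.geometry (Fin 3)) (hsDiameter σ N) (N + 1))

/-- **Deliverable (B): conditional integrability of `c W_φ` under the local Gibbs law** (`0 ≤ σ`,
any profiles, every `N`, `φ ∈ C¹` with `‖Dφ‖ ≤ L`, `0 ≤ t₁ ≤ t₂`): if the relative-speed functional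
`RS ∘ Φ_{t₁}` over `(0, t₂ − t₁]` is integrable under `μ_N = localGibbsLaw σ a₀ u₀ θ₀ N Φ`, then
`z ↦ (N+1)⁻¹ W_φ(Φ_{t₁} z, t₂ − t₁)` is `μ_N`-integrable and
`∫ |(N+1)⁻¹ W_φ ∘ Φ_{t₁}| dμ_N ≤ L σ_N (N+1)⁻¹ · ½ ∫ RS ∘ Φ_{t₁} dμ_N`, `σ_N = hsDiameter σ N`. [folklore] -/
theorem integrable_avg_momentumTransfer_flow_localGibbsLaw (hσ : 0 ≤ σ) {φ : T3 → V3}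
    (hφ : Torus.IsContDiff 1 φ) {L : ℝ} (hL : ∀ x, ‖Torus.fderiv φ x‖ ≤ L) {t₁ t₂ : ℝ} (h₁ : 0 ≤ t₁)
    (h₁₂ : t₁ ≤ t₂)
    (hRS : Integrable (fun z => Φ.collisionalTransferFunctional
      (fun (i j : Fin (N + 1)) (pre _post : Config (N + 1) (Fin 3) T3) => ‖(pre i).2 - (pre j).2‖)
      (Φ.flow t₁ z) (t₂ - t₁)) (localGibbsLaw σ a₀ u₀ θ₀ N Φ)) :
    Integrable (fun z => ((N + 1 : ℕ) : ℝ)⁻¹ * Φ.momentumTransfer φ (Φ.flow t₁ z) (t₂ - t₁))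
        (localGibbsLaw σ a₀ u₀ θ₀ N Φ) ∧
      ∫ z, |((N + 1 : ℕ) : ℝ)⁻¹ * Φ.momentumTransfer φ (Φ.flow t₁ z) (t₂ - t₁)|
          ∂localGibbsLaw σ a₀ u₀ θ₀ N Φ ≤
        L * hsDiameter σ N * ((N + 1 : ℕ) : ℝ)⁻¹ * (2⁻¹ * ∫ z, Φ.collisionalTransferFunctional
          (fun (i j : Fin (N + 1)) (pre _post : Config (N + 1) (Fin 3) T3) => ‖(pre i).2 - (pre j).2‖)
          (Φ.flow t₁ z) (t₂ - t₁) ∂localGibbsLaw σ a₀ u₀ θ₀ N Φ) := by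
  have hε : 0 ≤ hsDiameter σ N := mul_nonneg hσ (Real.rpow_nonneg (Nat.cast_nonneg _) _)
  obtain ⟨hint, hle⟩ := integrable_momentumTransfer_flow_of_integrable_relSpeed Φ hε hφ hL h₁ h₁₂
    (localGibbsLaw_absolutelyContinuous σ a₀ u₀ θ₀ N Φ) hRS
  have hc : 0 ≤ ((N + 1 : ℕ) : ℝ)⁻¹ := inv_nonneg.2 (Nat.cast_nonneg _)
  refine ⟨hint.const_mul _, ?_⟩
  simp only [abs_mul, abs_of_nonneg hc]
  rw [integral_const_mul]
  calc ((N + 1 : ℕ) : ℝ)⁻¹ * ∫ z, |Φ.momentumTransfer φ (Φ.flow t₁ z) (t₂ - t₁)| ∂localGibbsLaw σ a₀ u₀ θ₀ N Φ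
      ≤ ((N + 1 : ℕ) : ℝ)⁻¹ * (L * hsDiameter σ N * (2⁻¹ * ∫ z, Φ.collisionalTransferFunctional
          (fun (i j : Fin (N + 1)) (pre _post : Config (N + 1) (Fin 3) T3) => ‖(pre i).2 - (pre j).2‖)
          (Φ.flow t₁ z) (t₂ - t₁) ∂localGibbsLaw σ a₀ u₀ θ₀ N Φ)) := mul_le_mul_of_nonneg_left hle hc
    _ = _ := by ring

/-- **Conditional integrability of the Taylor remainder of `c W_φ` under the local Gibbs law**
(`0 ≤ σ < 1/2`, any profiles, every `N`, `φ ∈ C¹`, `Dφ ∈ C¹`, `‖D²φ‖ ≤ M`, `0 ≤ t₁ ≤ t₂`): if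
`RS ∘ Φ_{t₁}` is `μ_N`-integrable then `z ↦ (N+1)⁻¹ (W_φ − collisionalStress (Dφ))(Φ_{t₁} z, t₂ − t₁)`
is `μ_N`-integrable with `∫ |·| dμ_N ≤ ½ M σ_N² (N+1)⁻¹ · ½ ∫ RS ∘ Φ_{t₁} dμ_N` — so that, GIVEN a mean
bound `σ_N (N+1)⁻¹ ∫ RS dμ_N ≤ C` (stub FLUX), the stub's `c W_φ` may be replaced by the collisional
stress `c · collisionalStress (Dφ)` at cost `O(σ_N) → 0`. [folklore] -/
theorem integrable_avg_momentumTransfer_sub_collisionalStress_flow_localGibbsLaw (hσ : 0 ≤ σ)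
    (hσ₂ : σ < 2⁻¹) {φ : T3 → V3} (hφ : Torus.IsContDiff 1 φ) (hDφ : Torus.IsContDiff 1 (Torus.fderiv φ))
    {M : ℝ} (hM : ∀ x, ‖Torus.fderiv (Torus.fderiv φ) x‖ ≤ M) {t₁ t₂ : ℝ} (h₁ : 0 ≤ t₁) (h₁₂ : t₁ ≤ t₂)
    (hRS : Integrable (fun z => Φ.collisionalTransferFunctional
      (fun (i j : Fin (N + 1)) (pre _post : Config (N + 1) (Fin 3) T3) => ‖(pre i).2 - (pre j).2‖)
      (Φ.flow t₁ z) (t₂ - t₁)) (localGibbsLaw σ a₀ u₀ θ₀ N Φ)) :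
    Integrable (fun z => ((N + 1 : ℕ) : ℝ)⁻¹ * (Φ.momentumTransfer φ (Φ.flow t₁ z) (t₂ - t₁) -
        Φ.collisionalStress (Torus.fderiv φ) (Φ.flow t₁ z) (t₂ - t₁))) (localGibbsLaw σ a₀ u₀ θ₀ N Φ) ∧
      ∫ z, |((N + 1 : ℕ) : ℝ)⁻¹ * (Φ.momentumTransfer φ (Φ.flow t₁ z) (t₂ - t₁) -
          Φ.collisionalStress (Torus.fderiv φ) (Φ.flow t₁ z) (t₂ - t₁))| ∂localGibbsLaw σ a₀ u₀ θ₀ N Φ ≤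
        2⁻¹ * M * hsDiameter σ N ^ 2 * ((N + 1 : ℕ) : ℝ)⁻¹ * (2⁻¹ * ∫ z, Φ.collisionalTransferFunctional
          (fun (i j : Fin (N + 1)) (pre _post : Config (N + 1) (Fin 3) T3) => ‖(pre i).2 - (pre j).2‖)
          (Φ.flow t₁ z) (t₂ - t₁) ∂localGibbsLaw σ a₀ u₀ θ₀ N Φ) := by
  have hε : hsDiameter σ N < 2⁻¹ := (hsDiameter_le hσ N).trans_lt hσ₂
  obtain ⟨hint, hle⟩ := integrable_momentumTransfer_sub_collisionalStress_flow_of_integrable_relSpeed Φ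
    hε hφ hDφ hM h₁ h₁₂ (localGibbsLaw_absolutelyContinuous σ a₀ u₀ θ₀ N Φ) hRS
  have hc : 0 ≤ ((N + 1 : ℕ) : ℝ)⁻¹ := inv_nonneg.2 (Nat.cast_nonneg _)
  refine ⟨hint.const_mul _, ?_⟩
  simp only [abs_mul, abs_of_nonneg hc]
  rw [integral_const_mul]
  calc ((N + 1 : ℕ) : ℝ)⁻¹ * ∫ z, |Φ.momentumTransfer φ (Φ.flow t₁ z) (t₂ - t₁) -
          Φ.collisionalStress (Torus.fderiv φ) (Φ.flow t₁ z) (t₂ - t₁)| ∂localGibbsLaw σ a₀ u₀ θ₀ N Φ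
      ≤ ((N + 1 : ℕ) : ℝ)⁻¹ * (2⁻¹ * M * hsDiameter σ N ^ 2 * (2⁻¹ * ∫ z, Φ.collisionalTransferFunctional
          (fun (i j : Fin (N + 1)) (pre _post : Config (N + 1) (Fin 3) T3) => ‖(pre i).2 - (pre j).2‖)
          (Φ.flow t₁ z) (t₂ - t₁) ∂localGibbsLaw σ a₀ u₀ θ₀ N Φ)) := mul_le_mul_of_nonneg_left hle hc
    _ = _ := by ring


/-- **Deliverable (B) for a smooth field, constants chosen once for all `N`**: for `0 ≤ σ < 1/2`, any
profiles and a smooth `φ` there are `L, M ≥ 0` such that for every `N`, every flow `Φ`, all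
`0 ≤ t₁ ≤ t₂`: IF `RS ∘ Φ_{t₁}` is `μ_N`-integrable THEN `c W_φ ∘ Φ_{t₁}` and its Taylor remainder
`c (W_φ − collisionalStress (Dφ)) ∘ Φ_{t₁}` are `μ_N`-integrable with
`∫ |c W_φ ∘ Φ_{t₁}| ≤ L σ_N c ½ ∫RS` and `∫ |c (W_φ − collisionalStress (Dφ)) ∘ Φ_{t₁}| ≤ ½ M σ_N² c ½ ∫RS`. [folklore] -/
theorem exists_forall_integrable_avg_momentumTransfer_flow_localGibbsLaw (hσ : 0 ≤ σ) (hσ₂ : σ < 2⁻¹)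
    {φ : T3 → V3} (hφ : Torus.IsSmooth φ) :
    ∃ L M : ℝ, 0 ≤ L ∧ 0 ≤ M ∧ ∀ (N : ℕ)
      (Φ : HardSphereFlow (Torus.geometry (Fin 3)) (hsDiameter σ N) (N + 1)) (t₁ t₂ : ℝ), 0 ≤ t₁ → t₁ ≤ t₂ →
      Integrable (fun z => Φ.collisionalTransferFunctional
        (fun (i j : Fin (N + 1)) (pre _post : Config (N + 1) (Fin 3) T3) => ‖(pre i).2 - (pre j).2‖)
        (Φ.flow t₁ z) (t₂ - t₁)) (localGibbsLaw σ a₀ u₀ θ₀ N Φ) →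
      (Integrable (fun z => ((N + 1 : ℕ) : ℝ)⁻¹ * Φ.momentumTransfer φ (Φ.flow t₁ z) (t₂ - t₁))
          (localGibbsLaw σ a₀ u₀ θ₀ N Φ) ∧
        ∫ z, |((N + 1 : ℕ) : ℝ)⁻¹ * Φ.momentumTransfer φ (Φ.flow t₁ z) (t₂ - t₁)|
            ∂localGibbsLaw σ a₀ u₀ θ₀ N Φ ≤
          L * hsDiameter σ N * ((N + 1 : ℕ) : ℝ)⁻¹ * (2⁻¹ * ∫ z, Φ.collisionalTransferFunctional
            (fun (i j : Fin (N + 1)) (pre _post : Config (N + 1) (Fin 3) T3) => ‖(pre i).2 - (pre j).2‖)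
            (Φ.flow t₁ z) (t₂ - t₁) ∂localGibbsLaw σ a₀ u₀ θ₀ N Φ)) ∧
      (Integrable (fun z => ((N + 1 : ℕ) : ℝ)⁻¹ * (Φ.momentumTransfer φ (Φ.flow t₁ z) (t₂ - t₁) -
          Φ.collisionalStress (Torus.fderiv φ) (Φ.flow t₁ z) (t₂ - t₁))) (localGibbsLaw σ a₀ u₀ θ₀ N Φ) ∧
        ∫ z, |((N + 1 : ℕ) : ℝ)⁻¹ * (Φ.momentumTransfer φ (Φ.flow t₁ z) (t₂ - t₁) -
            Φ.collisionalStress (Torus.fderiv φ) (Φ.flow t₁ z) (t₂ - t₁))| ∂localGibbsLaw σ a₀ u₀ θ₀ N Φ ≤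
          2⁻¹ * M * hsDiameter σ N ^ 2 * ((N + 1 : ℕ) : ℝ)⁻¹ * (2⁻¹ * ∫ z, Φ.collisionalTransferFunctional
            (fun (i j : Fin (N + 1)) (pre _post : Config (N + 1) (Fin 3) T3) => ‖(pre i).2 - (pre j).2‖)
            (Φ.flow t₁ z) (t₂ - t₁) ∂localGibbsLaw σ a₀ u₀ θ₀ N Φ)) := by
  obtain ⟨h1, h2, ⟨L, hL0, hL⟩, ⟨M, hM0, hM⟩⟩ := exists_bounds_of_isSmooth hφ
  exact ⟨L, M, hL0, hM0, fun N Φ t₁ t₂ h₁ h₁₂ hRS =>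
    ⟨integrable_avg_momentumTransfer_flow_localGibbsLaw a₀ θ₀ u₀ N Φ hσ h1 hL h₁ h₁₂ hRS,
      integrable_avg_momentumTransfer_sub_collisionalStress_flow_localGibbsLaw a₀ θ₀ u₀ N Φ hσ hσ₂ h1 h2 hM
        h₁ h₁₂ hRS⟩⟩

end LocalGibbs

end CollisionalStressClosure

open CollisionalStressClosure in
/-- **Registered sub-goal `stub_collisionalStressTransferMeanBound` of stmt-AtomisticToContinuum-9256
(stub CS, conditional mean part; EOS-free).** For every smooth vector field `φ` on `T³` there are
`L, M ≥ 0` (`L = ½ sup ‖Dφ‖`, `M = ¼ sup ‖D²φ‖`) such that for all `0 ≤ σ < 1/2`, all profiles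
`a₀, θ₀, u₀`, every `N`, every flow `Φ` and all `0 ≤ t₁ ≤ t₂`: IF the relative-speed collision
functional `RS` of the time-`t₁` point over `(0, t₂ − t₁]` is integrable under the local Gibbs law
`μ_N` THEN the stub's collisional term `c W_φ ∘ Φ_{t₁}` (`c = (N+1)⁻¹`) is `μ_N`-integrable with
`∫ |c W_φ ∘ Φ_{t₁}| dμ_N ≤ L σ_N c ∫ RS dμ_N`, and its Taylor remainder
`c (W_φ − collisionalStress (Dφ)) ∘ Φ_{t₁}` is `μ_N`-integrable with
`∫ |·| dμ_N ≤ M σ_N² c ∫ RS dμ_N` (`σ_N = hsDiameter σ N`). [folklore] -/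
theorem stub_collisionalStressTransferMeanBound : ∀ (φ : Literature.MathematicalPhysics.KineticTheory.T3 → Literature.MathematicalPhysics.KineticTheory.V3), Literature.Analysis.FunctionSpaces.Torus.IsSmooth φ → ∃ L M : ℝ, 0 ≤ L ∧ 0 ≤ M ∧ ∀ (σ : ℝ), 0 ≤ σ → σ < 1 / 2 → ∀ (a₀ θ₀ : Literature.MathematicalPhysics.KineticTheory.T3 → ℝ) (u₀ : Literature.MathematicalPhysics.KineticTheory.T3 → Literature.MathematicalPhysics.KineticTheory.V3) (N : ℕ) (Φ : Literature.Analysis.FluidPDE.HardSphereFlow (Literature.Analysis.FluidPDE.Torus.geometry (Fin 3)) (Literature.MathematicalPhysics.KineticTheory.hsDiameter σ N) (N + 1)) (t₁ t₂ : ℝ), 0 ≤ t₁ → t₁ ≤ t₂ → MeasureTheory.Integrable (fun z => Φ.collisionalTransferFunctional (fun (i j : Fin (N + 1)) (pre _post : Literature.Analysis.FluidPDE.Config (N + 1) (Fin 3) Literature.MathematicalPhysics.KineticTheory.T3) => ‖(pre i).2 - (pre j).2‖) (Φ.flow t₁ z) (t₂ - t₁)) (Literature.MathematicalPhysics.KineticTheory.localGibbsLaw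 σ a₀ u₀ θ₀ N Φ) → (MeasureTheory.Integrable (fun z => ((N + 1 : ℕ) : ℝ)⁻¹ * Φ.momentumTransfer φ (Φ.flow t₁ z) (t₂ - t₁)) (Literature.MathematicalPhysics.KineticTheory.localGibbsLaw σ a₀ u₀ θ₀ N Φ) ∧ ∫ z, |((N + 1 : ℕ) : ℝ)⁻¹ * Φ.momentumTransfer φ (Φ.flow t₁ z) (t₂ - t₁)| ∂Literature.MathematicalPhysics.KineticTheory.localGibbsLaw σ a₀ u₀ θ₀ N Φ ≤ L * Literature.MathematicalPhysics.KineticTheory.hsDiameter σ N * ((N + 1 : ℕ) : ℝ)⁻¹ * ∫ z, Φ.collisionalTransferFunctional (fun (i j : Fin (N + 1)) (pre _post : Literature.Analysis.FluidPDE.Config (N + 1) (Fin 3) Literature.MathematicalPhysics.KineticTheory.T3) => ‖(pre i).2 - (pre j).2‖) (Φ.flow t₁ z) (t₂ - t₁) ∂Literature.MathematicalPhysics.KineticTheory.localGibbsLaw σ a₀ u₀ θ₀ N Φ) ∧ (MeasureTheory.Integrable (fun z => ((N + 1 : ℕ) : ℝ)⁻¹ * (Φ.momentumTransfer φ (Φ.flow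 t₁ z) (t₂ - t₁) - Φ.collisionalStress (Literature.Analysis.FunctionSpaces.Torus.fderiv φ) (Φ.flow t₁ z) (t₂ - t₁))) (Literature.MathematicalPhysics.KineticTheory.localGibbsLaw σ a₀ u₀ θ₀ N Φ) ∧ ∫ z, |((N + 1 : ℕ) : ℝ)⁻¹ * (Φ.momentumTransfer φ (Φ.flow t₁ z) (t₂ - t₁) - Φ.collisionalStress (Literature.Analysis.FunctionSpaces.Torus.fderiv φ) (Φ.flow t₁ z) (t₂ - t₁))| ∂Literature.MathematicalPhysics.KineticTheory.localGibbsLaw σ a₀ u₀ θ₀ N Φ ≤ M * Literature.MathematicalPhysics.KineticTheory.hsDiameter σ N ^ 2 * ((N + 1 : ℕ) : ℝ)⁻¹ * ∫ z, Φ.collisionalTransferFunctional (fun (i j : Fin (N + 1)) (pre _post : Literature.Analysis.FluidPDE.Config (N + 1) (Fin 3) Literature.MathematicalPhysics.KineticTheory.T3) => ‖(pre i).2 - (pre j).2‖) (Φ.flow t₁ z) (t₂ - t₁) ∂Literature.MathematicalPhysics.KineticTheory.localGibbsLaw σ a₀ u₀ θ₀ N Φ) := by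
  intro φ hφ
  obtain ⟨h1, h2, ⟨L, hL0, hL⟩, ⟨M, hM0, hM⟩⟩ := exists_bounds_of_isSmooth hφ
  refine ⟨L * 2⁻¹, 2⁻¹ * M * 2⁻¹, by positivity, by positivity, ?_⟩
  intro σ hσ hσ₂ a₀ θ₀ u₀ N Φ t₁ t₂ h₁ h₁₂ hRS
  have hσ₂' : σ < 2⁻¹ := by simpa only [one_div] using hσ₂
  obtain ⟨hiW, hW⟩ := integrable_avg_momentumTransfer_flow_localGibbsLaw a₀ θ₀ u₀ N Φ hσ h1 hL h₁ h₁₂ hRS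
  obtain ⟨hiR, hR⟩ := integrable_avg_momentumTransfer_sub_collisionalStress_flow_localGibbsLaw a₀ θ₀ u₀ N Φ
    hσ hσ₂' h1 h2 hM h₁ h₁₂ hRS
  exact ⟨⟨hiW, hW.trans_eq (by ring)⟩, ⟨hiR, hR.trans_eq (by ring)⟩⟩

end Summit.AtomisticToContinuum.HydrodynamicLimit.Theorems
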